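import Summits.BirchSwinnertonDyer.Rank1Residual.X9.PrintCertHeegnerCertsX9Ns
import Summits.BirchSwinnertonDyer.Rank1Residual.X9.PrintCertTamagawaCertifiedX9Ns
import Summits.BirchSwinnertonDyer.Rank1Residual.X9.PrintCertRecordsCertifiedX9Ns
import HarnessLib

/-!
# The Heegner frame certificates PASS IN THE KERNEL — leaf X9, images `5Ns` / `7Ns` (J frames, `p` split): display theorems, screen census

HONEST FRAMING (cell `bsd-print-x9`, D-0131 (2) print tier): theorems only; no named fact; nothing asserted about any elliptic
curve beyond what the kernel rechecks; no pair is booked and no leaf is closed (`BSDpOnClassX9`, `BSDpOnClassX10b` stay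
`@[conjecture]`; cruxes J = item 20392 `HeegnerDivisibilityX9`, J₃ = item 21340 `HeegnerDivisibilityX10b` stay OPEN — their `∃ B, ∀ |d_K| > B`
shape is not refutable by finitely many frames). For each slice: `heegnerScreen_<Slice>` — every rank-`1` record has a Heegner
frame certificate (`X9/PrintCertHeegnerCerts*.lean`) passing `Record.heegnerCheck` (`X9/PrintCertHeegner.lean`), by `decide +kernel`;
hence (`X9/PrintCertHeegner.lean` soundness) for ANY imaginary quadratic `K` with `d_K = c.D` and ANY globally minimal `W / ℚ` with
`integralModelInt W = r.intCurve`: `frame_of_mem_<Slice>` — `K` satisfies the Heegner hypothesis for `N(W)` and for `p`, `|d_K| > 4`,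
`4N ∣ β² − d_K` — and `screen_of_mem_<Slice>` — `ord_p ∏_ℓ c_ℓ(W) ≤ v_p(m_K)` IN THE KERNEL'S CURRENCY
(through the slice's Tamagawa row certificates), `m_K` being the two-engine Heegner index of the frame (CLAIM, display file).
Kernel census `screenCensus_<Slice>`: how many frames have `v_p(m_K) = t` (then `Ш(E/K)[p] = 0` by Gross–Zagier–BSD, Jetchev Conj. 1.1)
and how many `v_p(m_K) > t` (`Ш(E^D)[p] ≠ 0`: `p^t ∣ y_K` with room to spare); none has `v_p(m_K) < t`.

References: [Jetchev2008] Conj. 1.1, Rem. 1.2, Thm. 1.4; [GrossZagier1986] V (2.1)–(2.3); [GrossLMS1991] §1; [Marcus1977] Ch. 3 Thm. 25.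
-/

set_option autoImplicit false

namespace Summit.BirchSwinnertonDyer.Rank1Residual.X9.PrintCert

open WeierstrassCurve Summit.BirchSwinnertonDyer.Rank1Residual.Additive
open Literature.NumberTheory.EllipticCurves (IsImaginaryQuadratic SatisfiesHeegnerHypothesis)

-- `decide +kernel` runs the frame arithmetic, trial divisions and `p`-adic valuations on every record: raise the recursion depth.
set_option maxRecDepth 100000

/-! ## Slice `Ns5A` (65 records, 39 of analytic rank `1`, 39 certificates) -/

/-- Every rank-`1` record of slice `Ns5A` has a Heegner frame certificate passing `Record.heegnerCheck`, IN THE KERNEL. [cite: Jetchev2008, Conj. 1.1] -/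
theorem heegnerScreen_Ns5A : heegnerScreen recordsNs5A (fun r => r.rank == 1) heegnerCertsNs5A = true := by
  decide +kernel

/-- Unpacked: a rank-`1` record of slice `Ns5A` has a passing Heegner frame certificate in `heegnerCertsNs5A`. [cite: Jetchev2008, Conj. 1.1] -/
theorem exists_heegnerCheck_of_mem_Ns5A {r : Record} (hr : r ∈ recordsNs5A) (h1 : r.rank = 1) :
    ∃ c ∈ heegnerCertsNs5A, r.heegnerCheck c = true :=
  exists_heegnerCheck_of_heegnerScreen heegnerScreen_Ns5A hr (by simp [h1])

/-- **THE FRAME, slice `Ns5A`**: for a rank-`1` record, ANY imaginary quadratic `K` whose discriminant is the certificate's `D`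
satisfies the frame binders of crux J (item 20392): Heegner hypothesis for `N(W)` and for `p`, `|d_K| > 4`,
`4N ∣ β² − d_K` (record conductor), for ANY globally minimal `W` with the record's integral model. [cite: GrossLMS1991, §1 (p. 235)] [cite: Marcus1977, Ch. 3 Thm. 25] -/
theorem frame_of_mem_Ns5A {r : Record} (hr : r ∈ recordsNs5A) (h1 : r.rank = 1) {W : WeierstrassCurve ℚ} [W.IsElliptic]
    [W.IsGloballyMinimal] (hI : integralModelInt W = r.intCurve) {K : Type} [Field K] [NumberField K]
    (hK : IsImaginaryQuadratic K) {q : ℕ} (hq : q = r.p) :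
    ∃ c ∈ heegnerCertsNs5A, r.heegnerCheck c = true ∧ (NumberField.discr K = c.D →
      SatisfiesHeegnerHypothesis (W.conductorNorm ℤ) K ∧ SatisfiesHeegnerHypothesis q K ∧ 4 < (NumberField.discr K).natAbs ∧
      (4 * (r.conductor : ℤ)) ∣ (c.beta : ℤ) ^ 2 - NumberField.discr K ∧ (q = 3 → NumberField.discr K % 8 = 1)) := by
  obtain ⟨c, hc, hh⟩ := exists_heegnerCheck_of_mem_Ns5A hr h1
  exact ⟨c, hc, hh, fun hd => Record.frame_of_heegnerCheck hI (certified_Ns5A.check_of_mem hr) hh hK hd hq⟩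

/-- **THE SCREEN, slice `Ns5A`**: for a rank-`1` record and ANY globally minimal `W` with the record's integral model, the kernel
Tamagawa depth satisfies `ord_p ∏_ℓ c_ℓ(W) ≤ v_p(m_K)` for the frame's two-engine Heegner index `m_K = c.index` — the `n = 1`, `s = t`
instance of crux J on that frame, granted the display file's claim that `m_K` is the index. [cite: Jetchev2008, Conj. 1.1, Thm. 1.4] -/
theorem screen_of_mem_Ns5A {r : Record} (hr : r ∈ recordsNs5A) (h1 : r.rank = 1) {W : WeierstrassCurve ℚ} [W.IsElliptic]
    [W.IsGloballyMinimal] (hI : integralModelInt W = r.intCurve) {q : ℕ} (hq : q = r.p) :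
    ∃ c ∈ heegnerCertsNs5A, r.heegnerCheck c = true ∧ padicValNat q W.tamagawaProduct ≤ c.indexVal ∧
      2 * c.indexVal = 2 * padicValNat q W.tamagawaProduct + padicValNat q (r.shaAn * c.twistSha) := by
  obtain ⟨c, hc, hh⟩ := exists_heegnerCheck_of_mem_Ns5A hr h1
  obtain ⟨tc, -, htc⟩ := exists_tamCheck_of_mem_Ns5A hr
  exact ⟨c, hc, hh, Record.padicValNat_tamagawaProduct_le_indexVal_of_heegnerCheck hI hh htc hq,
    Record.two_mul_indexVal_eq_of_heegnerCheck hI hh htc hq⟩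

/-- KERNEL CENSUS, slice `Ns5A`: 39 certificates; `v_p(m_K) = t` on 32 frames (`Ш(E/K)[p] = 0` predicted), `v_p(m_K) > t` on 7
(`Ш(E^D)[p] ≠ 0`), `v_p(m_K) < t` on 0. [cite: Jetchev2008, Conj. 1.1] -/
theorem screenCensus_Ns5A : heegnerCertsNs5A.length = 39 ∧
    (heegnerCertsNs5A.filter fun c => c.indexVal == c.depth).length = 32 ∧
    (heegnerCertsNs5A.filter fun c => decide (c.depth < c.indexVal)).length = 7 ∧
    (heegnerCertsNs5A.filter fun c => decide (c.indexVal < c.depth)).length = 0 := by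
  decide +kernel

/-! ### Further frames of the J-live records of slice `Ns5A` (44 certificates) -/

/-- Every FURTHER frame certificate of slice `Ns5A` passes `Record.heegnerCheck` against a rank-`1` record of the slice, IN THE KERNEL
(so each is a route-compatible frame with the `n = 1` screen, by the soundness theorems of `X9/PrintCertHeegner.lean`). [cite: Jetchev2008, Conj. 1.1] -/
theorem extraPass_Ns5A : (heegnerCertsNs5AExtra.all fun c => recordsNs5A.any fun r => (r.rank == 1) && r.heegnerCheck c) = true := by
  decide +kernel

/-- Unpacked: each further frame certificate belongs to a rank-`1` record of slice `Ns5A` that it passes against. [cite: Jetchev2008, Conj. 1.1] -/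
theorem exists_record_of_mem_Ns5AExtra {c : HeegnerCert} (hc : c ∈ heegnerCertsNs5AExtra) :
    ∃ r ∈ recordsNs5A, r.rank = 1 ∧ r.heegnerCheck c = true := by
  have h := List.all_eq_true.1 extraPass_Ns5A c hc
  simp only [List.any_eq_true, Bool.and_eq_true, beq_iff_eq] at h
  obtain ⟨r, hr, h1, hh⟩ := h
  exact ⟨r, hr, h1, hh⟩

/-- KERNEL CENSUS of the further frames of slice `Ns5A`: 44 certificates; `v_p(m_K) = t` on 42, `> t` on 2 (listed with `D`),
`< t` on 0. [cite: Jetchev2008, Conj. 1.1] -/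
theorem extraCensus_Ns5A : heegnerCertsNs5AExtra.length = 44 ∧
    (heegnerCertsNs5AExtra.filter fun c => c.indexVal == c.depth).length = 42 ∧
    ((heegnerCertsNs5AExtra.filter fun c => decide (c.depth < c.indexVal)).map fun c => (c.label, c.D)) = [("10082l1", -39), ("65728y1", -199)] ∧
    (heegnerCertsNs5AExtra.filter fun c => decide (c.indexVal < c.depth)).length = 0 := by
  refine ⟨?_, ?_, ?_, ?_⟩ <;> decide +kernel

/-! ## Slice `Ns5B` (65 records, 29 of analytic rank `1`, 29 certificates) -/

/-- Every rank-`1` record of slice `Ns5B` has a Heegner frame certificate passing `Record.heegnerCheck`, IN THE KERNEL. [cite: Jetchev2008, Conj. 1.1] -/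
theorem heegnerScreen_Ns5B : heegnerScreen recordsNs5B (fun r => r.rank == 1) heegnerCertsNs5B = true := by
  decide +kernel

/-- Unpacked: a rank-`1` record of slice `Ns5B` has a passing Heegner frame certificate in `heegnerCertsNs5B`. [cite: Jetchev2008, Conj. 1.1] -/
theorem exists_heegnerCheck_of_mem_Ns5B {r : Record} (hr : r ∈ recordsNs5B) (h1 : r.rank = 1) :
    ∃ c ∈ heegnerCertsNs5B, r.heegnerCheck c = true :=
  exists_heegnerCheck_of_heegnerScreen heegnerScreen_Ns5B hr (by simp [h1])

/-- **THE FRAME, slice `Ns5B`**: for a rank-`1` record, ANY imaginary quadratic `K` whose discriminant is the certificate's `D`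
satisfies the frame binders of crux J (item 20392): Heegner hypothesis for `N(W)` and for `p`, `|d_K| > 4`,
`4N ∣ β² − d_K` (record conductor), for ANY globally minimal `W` with the record's integral model. [cite: GrossLMS1991, §1 (p. 235)] [cite: Marcus1977, Ch. 3 Thm. 25] -/
theorem frame_of_mem_Ns5B {r : Record} (hr : r ∈ recordsNs5B) (h1 : r.rank = 1) {W : WeierstrassCurve ℚ} [W.IsElliptic]
    [W.IsGloballyMinimal] (hI : integralModelInt W = r.intCurve) {K : Type} [Field K] [NumberField K]
    (hK : IsImaginaryQuadratic K) {q : ℕ} (hq : q = r.p) :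
    ∃ c ∈ heegnerCertsNs5B, r.heegnerCheck c = true ∧ (NumberField.discr K = c.D →
      SatisfiesHeegnerHypothesis (W.conductorNorm ℤ) K ∧ SatisfiesHeegnerHypothesis q K ∧ 4 < (NumberField.discr K).natAbs ∧
      (4 * (r.conductor : ℤ)) ∣ (c.beta : ℤ) ^ 2 - NumberField.discr K ∧ (q = 3 → NumberField.discr K % 8 = 1)) := by
  obtain ⟨c, hc, hh⟩ := exists_heegnerCheck_of_mem_Ns5B hr h1
  exact ⟨c, hc, hh, fun hd => Record.frame_of_heegnerCheck hI (certified_Ns5B.check_of_mem hr) hh hK hd hq⟩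

/-- **THE SCREEN, slice `Ns5B`**: for a rank-`1` record and ANY globally minimal `W` with the record's integral model, the kernel
Tamagawa depth satisfies `ord_p ∏_ℓ c_ℓ(W) ≤ v_p(m_K)` for the frame's two-engine Heegner index `m_K = c.index` — the `n = 1`, `s = t`
instance of crux J on that frame, granted the display file's claim that `m_K` is the index. [cite: Jetchev2008, Conj. 1.1, Thm. 1.4] -/
theorem screen_of_mem_Ns5B {r : Record} (hr : r ∈ recordsNs5B) (h1 : r.rank = 1) {W : WeierstrassCurve ℚ} [W.IsElliptic]
    [W.IsGloballyMinimal] (hI : integralModelInt W = r.intCurve) {q : ℕ} (hq : q = r.p) :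
    ∃ c ∈ heegnerCertsNs5B, r.heegnerCheck c = true ∧ padicValNat q W.tamagawaProduct ≤ c.indexVal ∧
      2 * c.indexVal = 2 * padicValNat q W.tamagawaProduct + padicValNat q (r.shaAn * c.twistSha) := by
  obtain ⟨c, hc, hh⟩ := exists_heegnerCheck_of_mem_Ns5B hr h1
  obtain ⟨tc, -, htc⟩ := exists_tamCheck_of_mem_Ns5B hr
  exact ⟨c, hc, hh, Record.padicValNat_tamagawaProduct_le_indexVal_of_heegnerCheck hI hh htc hq,
    Record.two_mul_indexVal_eq_of_heegnerCheck hI hh htc hq⟩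

/-- KERNEL CENSUS, slice `Ns5B`: 29 certificates; `v_p(m_K) = t` on 25 frames (`Ш(E/K)[p] = 0` predicted), `v_p(m_K) > t` on 4
(`Ш(E^D)[p] ≠ 0`), `v_p(m_K) < t` on 0. [cite: Jetchev2008, Conj. 1.1] -/
theorem screenCensus_Ns5B : heegnerCertsNs5B.length = 29 ∧
    (heegnerCertsNs5B.filter fun c => c.indexVal == c.depth).length = 25 ∧
    (heegnerCertsNs5B.filter fun c => decide (c.depth < c.indexVal)).length = 4 ∧
    (heegnerCertsNs5B.filter fun c => decide (c.indexVal < c.depth)).length = 0 := by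
  decide +kernel

/-! ### Further frames of the J-live records of slice `Ns5B` (26 certificates) -/

/-- Every FURTHER frame certificate of slice `Ns5B` passes `Record.heegnerCheck` against a rank-`1` record of the slice, IN THE KERNEL
(so each is a route-compatible frame with the `n = 1` screen, by the soundness theorems of `X9/PrintCertHeegner.lean`). [cite: Jetchev2008, Conj. 1.1] -/
theorem extraPass_Ns5B : (heegnerCertsNs5BExtra.all fun c => recordsNs5B.any fun r => (r.rank == 1) && r.heegnerCheck c) = true := by
  decide +kernel

/-- Unpacked: each further frame certificate belongs to a rank-`1` record of slice `Ns5B` that it passes against. [cite: Jetchev2008, Conj. 1.1] -/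
theorem exists_record_of_mem_Ns5BExtra {c : HeegnerCert} (hc : c ∈ heegnerCertsNs5BExtra) :
    ∃ r ∈ recordsNs5B, r.rank = 1 ∧ r.heegnerCheck c = true := by
  have h := List.all_eq_true.1 extraPass_Ns5B c hc
  simp only [List.any_eq_true, Bool.and_eq_true, beq_iff_eq] at h
  obtain ⟨r, hr, h1, hh⟩ := h
  exact ⟨r, hr, h1, hh⟩

/-- KERNEL CENSUS of the further frames of slice `Ns5B`: 26 certificates; `v_p(m_K) = t` on 26, `> t` on 0 (listed with `D`),
`< t` on 0. [cite: Jetchev2008, Conj. 1.1] -/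
theorem extraCensus_Ns5B : heegnerCertsNs5BExtra.length = 26 ∧
    (heegnerCertsNs5BExtra.filter fun c => c.indexVal == c.depth).length = 26 ∧
    ((heegnerCertsNs5BExtra.filter fun c => decide (c.depth < c.indexVal)).map fun c => (c.label, c.D)) = [] ∧
    (heegnerCertsNs5BExtra.filter fun c => decide (c.indexVal < c.depth)).length = 0 := by
  refine ⟨?_, ?_, ?_, ?_⟩ <;> decide +kernel

/-! ## Slice `Ns7` (36 records, 20 of analytic rank `1`, 20 certificates) -/

/-- Every rank-`1` record of slice `Ns7` has a Heegner frame certificate passing `Record.heegnerCheck`, IN THE KERNEL. [cite: Jetchev2008, Conj. 1.1] -/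
theorem heegnerScreen_Ns7 : heegnerScreen recordsNs7 (fun r => r.rank == 1) heegnerCertsNs7 = true := by
  decide +kernel

/-- Unpacked: a rank-`1` record of slice `Ns7` has a passing Heegner frame certificate in `heegnerCertsNs7`. [cite: Jetchev2008, Conj. 1.1] -/
theorem exists_heegnerCheck_of_mem_Ns7 {r : Record} (hr : r ∈ recordsNs7) (h1 : r.rank = 1) :
    ∃ c ∈ heegnerCertsNs7, r.heegnerCheck c = true :=
  exists_heegnerCheck_of_heegnerScreen heegnerScreen_Ns7 hr (by simp [h1])

/-- **THE FRAME, slice `Ns7`**: for a rank-`1` record, ANY imaginary quadratic `K` whose discriminant is the certificate's `D`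
satisfies the frame binders of crux J (item 20392): Heegner hypothesis for `N(W)` and for `p`, `|d_K| > 4`,
`4N ∣ β² − d_K` (record conductor), for ANY globally minimal `W` with the record's integral model. [cite: GrossLMS1991, §1 (p. 235)] [cite: Marcus1977, Ch. 3 Thm. 25] -/
theorem frame_of_mem_Ns7 {r : Record} (hr : r ∈ recordsNs7) (h1 : r.rank = 1) {W : WeierstrassCurve ℚ} [W.IsElliptic]
    [W.IsGloballyMinimal] (hI : integralModelInt W = r.intCurve) {K : Type} [Field K] [NumberField K]
    (hK : IsImaginaryQuadratic K) {q : ℕ} (hq : q = r.p) :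
    ∃ c ∈ heegnerCertsNs7, r.heegnerCheck c = true ∧ (NumberField.discr K = c.D →
      SatisfiesHeegnerHypothesis (W.conductorNorm ℤ) K ∧ SatisfiesHeegnerHypothesis q K ∧ 4 < (NumberField.discr K).natAbs ∧
      (4 * (r.conductor : ℤ)) ∣ (c.beta : ℤ) ^ 2 - NumberField.discr K ∧ (q = 3 → NumberField.discr K % 8 = 1)) := by
  obtain ⟨c, hc, hh⟩ := exists_heegnerCheck_of_mem_Ns7 hr h1
  exact ⟨c, hc, hh, fun hd => Record.frame_of_heegnerCheck hI (certified_Ns7.check_of_mem hr) hh hK hd hq⟩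

/-- **THE SCREEN, slice `Ns7`**: for a rank-`1` record and ANY globally minimal `W` with the record's integral model, the kernel
Tamagawa depth satisfies `ord_p ∏_ℓ c_ℓ(W) ≤ v_p(m_K)` for the frame's two-engine Heegner index `m_K = c.index` — the `n = 1`, `s = t`
instance of crux J on that frame, granted the display file's claim that `m_K` is the index. [cite: Jetchev2008, Conj. 1.1, Thm. 1.4] -/
theorem screen_of_mem_Ns7 {r : Record} (hr : r ∈ recordsNs7) (h1 : r.rank = 1) {W : WeierstrassCurve ℚ} [W.IsElliptic]
    [W.IsGloballyMinimal] (hI : integralModelInt W = r.intCurve) {q : ℕ} (hq : q = r.p) :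
    ∃ c ∈ heegnerCertsNs7, r.heegnerCheck c = true ∧ padicValNat q W.tamagawaProduct ≤ c.indexVal ∧
      2 * c.indexVal = 2 * padicValNat q W.tamagawaProduct + padicValNat q (r.shaAn * c.twistSha) := by
  obtain ⟨c, hc, hh⟩ := exists_heegnerCheck_of_mem_Ns7 hr h1
  obtain ⟨tc, -, htc⟩ := exists_tamCheck_of_mem_Ns7 hr
  exact ⟨c, hc, hh, Record.padicValNat_tamagawaProduct_le_indexVal_of_heegnerCheck hI hh htc hq,
    Record.two_mul_indexVal_eq_of_heegnerCheck hI hh htc hq⟩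

/-- KERNEL CENSUS, slice `Ns7`: 20 certificates; `v_p(m_K) = t` on 20 frames (`Ш(E/K)[p] = 0` predicted), `v_p(m_K) > t` on 0
(`Ш(E^D)[p] ≠ 0`), `v_p(m_K) < t` on 0. [cite: Jetchev2008, Conj. 1.1] -/
theorem screenCensus_Ns7 : heegnerCertsNs7.length = 20 ∧
    (heegnerCertsNs7.filter fun c => c.indexVal == c.depth).length = 20 ∧
    (heegnerCertsNs7.filter fun c => decide (c.depth < c.indexVal)).length = 0 ∧
    (heegnerCertsNs7.filter fun c => decide (c.indexVal < c.depth)).length = 0 := by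
  decide +kernel

/-! ### Further frames of the J-live records of slice `Ns7` (20 certificates) -/

/-- Every FURTHER frame certificate of slice `Ns7` passes `Record.heegnerCheck` against a rank-`1` record of the slice, IN THE KERNEL
(so each is a route-compatible frame with the `n = 1` screen, by the soundness theorems of `X9/PrintCertHeegner.lean`). [cite: Jetchev2008, Conj. 1.1] -/
theorem extraPass_Ns7 : (heegnerCertsNs7Extra.all fun c => recordsNs7.any fun r => (r.rank == 1) && r.heegnerCheck c) = true := by
  decide +kernel

/-- Unpacked: each further frame certificate belongs to a rank-`1` record of slice `Ns7` that it passes against. [cite: Jetchev2008, Conj. 1.1] -/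
theorem exists_record_of_mem_Ns7Extra {c : HeegnerCert} (hc : c ∈ heegnerCertsNs7Extra) :
    ∃ r ∈ recordsNs7, r.rank = 1 ∧ r.heegnerCheck c = true := by
  have h := List.all_eq_true.1 extraPass_Ns7 c hc
  simp only [List.any_eq_true, Bool.and_eq_true, beq_iff_eq] at h
  obtain ⟨r, hr, h1, hh⟩ := h
  exact ⟨r, hr, h1, hh⟩

/-- KERNEL CENSUS of the further frames of slice `Ns7`: 20 certificates; `v_p(m_K) = t` on 19, `> t` on 1 (listed with `D`),
`< t` on 0. [cite: Jetchev2008, Conj. 1.1] -/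
theorem extraCensus_Ns7 : heegnerCertsNs7Extra.length = 20 ∧
    (heegnerCertsNs7Extra.filter fun c => c.indexVal == c.depth).length = 19 ∧
    ((heegnerCertsNs7Extra.filter fun c => decide (c.depth < c.indexVal)).map fun c => (c.label, c.D)) = [("147600dq1", -1679)] ∧
    (heegnerCertsNs7Extra.filter fun c => decide (c.indexVal < c.depth)).length = 0 := by
  refine ⟨?_, ?_, ?_, ?_⟩ <;> decide +kernel

end Summit.BirchSwinnertonDyer.Rank1Residual.X9.PrintCert
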